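import Summits.HodgeConjecture.CorCM.Census.DecicWeil23Multi
import Mathlib.GroupTheory.Perm.Basic
import HarnessLib

/-!
# A sextic `(1,2)`-threefold `T` and an octic `(1,3)`-fourfold `B` over TWO CM fields `K₁ ⊇ k ⊆ K₂` sharing the imaginary
# quadratic field `k`: `E × T × B` — the finite model of the balanced weights of every product of copies, the two types read
# through an ARBITRARY pair of permutations of the conjugate pairs

COR-CM (cell `pub-hodgecm2`), seat b30 gen 26 (2026-08-23); count-neutral own lane SEXTIC-OCTIC = the two-DEGREE successor of
`Census/DihedralSexticPairCurve*` (one sextic field), `Census/OcticCurveFourfold*` (one octic field) and of the TWO-FIELD chain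
`CorCM/TwoSexticFields*` (two sextic fields): ONE curve slot `E` (CM by `k`), ONE threefold slot `T` (CM by a SEXTIC field
`K₁ ⊇ i₁(k)`, type of `k`-signature `(1,2)`: exactly one embedding over `τ`) and ONE fourfold slot `B` (CM by an OCTIC field
`K₂ ⊇ i₂(k)`, type of `k`-signature `(1,3)`).  Bookkeeping definitions and theorems of a finite model; no named fact, no geometry,
no `sorry`, no `decide`.

SETTING (formalised downstream, `CorCM/SexticOcticWeilFrameTransfer`).  Frames `e₁ : Hom(K₁, ℂ) ≃ Fin 3 × Bool`,
`e₂ : Hom(K₂, ℂ) ≃ Fin 4 × Bool` (`(e_m s).2 = [s ∘ i_m = τ]`, `e_m s̄ = ((e_m s).1, ¬(e_m s).2)`) reading the two types as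
`s ∈ Φ_m ⟺ (e_m s).2 = [(e_m s).1 = 0]` (the member over `τ` at position `0`); `R ⊆ Sym(3) × Sym(4)` the PAIRS of permutations of
the conjugate pairs of `K₁` and of `K₂` induced by ONE automorphism of `ℂ` fixing `τ`.

MODEL.  `PtS = Bool ⊕ ((Fin 3 × Bool) ⊕ (Fin 4 × Bool))` (`inl b` = the embedding `τ_b` of `k`; `inr (inl (a, b))` = the embedding
of `K₁` of sign `b` in the pair `a`; `inr (inr (a, b))` = the same for `K₂`); `phiS π = {inl true} ⊔ {inr (inl (a, [π.1 a = 0]))} ⊔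
{inr (inr (a, [π.2 a = 0]))} = π⁻¹(types)`; `ModelBalancedS R v T`: the equations `2 · #{x ∈ T | v x ∈ phiS π} = |T|`, `π ∈ R`.

RESULTS (kernel).  `cjS` (conjugation), membership, `phiS_eq`, `mem_phiS_iff_cjS_not_mem` (each `phiS π` is a CM type of the
model), counting fibrewise, and **the signed form** `balancedS_iff_signed` of the equation at `π`:
`(N t − N f) + Σ_a ± d₁(a) + Σ_b ± d₂(b) = 0` (`d₁(a) = N(1,a,t) − N(1,a,f)`, sign `+` iff `π.1 a = 0`; `d₂` alike).  THE
DEFECT LAW (from JOINT TRANSITIVITY of `R` on `Fin 3 × Fin 4`) is the sequel `Census/SexticOcticWeilDefect.lean`; parts, extraction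
and induction follow in `Census/SexticOcticWeil{Parts,Extraction}`.
[cite: Pohlmann1968, Thm 1] [cite: GaoUllmo2025, Thm 3.1] [cite: MoonenZarhin1995Duke, Thm. 2.4] [cite: Gordon1999HodgeAVSurvey, 5.13 (ii), 9.2.2]

## References
* [Pohlmann1968] H. Pohlmann, Ann. of Math. 88 (1968), Thm 1.  [GaoUllmo2025] Z. Gao, E. Ullmo, J. Inst. Math. Jussieu 25
  (2025), Thm 3.1.  [MoonenZarhin1995Duke] B. Moonen, Yu. Zarhin, Duke Math. J. 77 (1995), Thm. 2.4.  [Gordon1999HodgeAVSurvey]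
  B. B. Gordon, CRM Monogr. 10 (1999), 5.13 (ii), 9.2.2.

## Provenance
Exact python first (seat folder `work/scratch/census68.py`): under any set of realised pairs that is jointly transitive on
`Fin 3 × Fin 4` (e.g. `S₃ × S₄`, or a `12`-element subdirect subgroup), the balanced lattice of every product of copies of `E, T, B`
has nullity `10 = 8` conjugate pairs `+ 2` (`t₁, t₂`), with the defect law `d₁ ≡ t₁`, `d₂ ≡ t₂`, `e = t₁ + 2t₂`, and every reduced
balanced weight is a disjoint union of Weil FOURFOLD (`T × E`), SIXFOLD (`B × E × E`), EIGHTFOLD (`Ē × T × B̄`) and TENFOLD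
(`T × T × B̄`) weights.  Joint transitivity is automatic for a sextic and an octic field through `k` (coprime relative degrees).
-/

namespace Summit.HodgeConjecture.CorCM.Census.SexticOcticWeil

open Finset

/-! ### The model -/

/-- Points: `inl b` = embedding of `k` of sign `b`; `inr (inl (a, b))` = embedding of the sextic field `K₁` of sign `b` in the
pair `a < 3` (threefold slot); `inr (inr (a, b))` = embedding of the octic field `K₂` of sign `b` in the pair `a < 4` (fourfold slot).
[cite: GaoUllmo2025, §2.1] -/
abbrev PtS : Type := Bool ⊕ ((Fin 3 × Bool) ⊕ (Fin 4 × Bool))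

/-- Complex conjugation on the model: the sign flips. [folklore] -/
def cjS : PtS → PtS
  | Sum.inl b => Sum.inl (!b)
  | Sum.inr (Sum.inl (a, b)) => Sum.inr (Sum.inl (a, !b))
  | Sum.inr (Sum.inr (a, b)) => Sum.inr (Sum.inr (a, !b))

/-- Unfolding of `cjS`, curve slot. [folklore] -/
theorem cjS_inl (b : Bool) : cjS (Sum.inl b) = Sum.inl (!b) := rfl

/-- Unfolding of `cjS`, threefold slot. [folklore] -/
theorem cjS_inr_inl (a : Fin 3) (b : Bool) : cjS (Sum.inr (Sum.inl (a, b))) = Sum.inr (Sum.inl (a, !b)) := rfl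

/-- Unfolding of `cjS`, fourfold slot. [folklore] -/
theorem cjS_inr_inr (a : Fin 4) (b : Bool) : cjS (Sum.inr (Sum.inr (a, b))) = Sum.inr (Sum.inr (a, !b)) := rfl

/-- `cjS` is an involution. [folklore] -/
theorem cjS_cjS (y : PtS) : cjS (cjS y) = y := by
  rcases y with b | ⟨⟨a, b⟩ | ⟨a, b⟩⟩
  · rw [cjS_inl, cjS_inl, Bool.not_not]
  · rw [cjS_inr_inl, cjS_inr_inl, Bool.not_not]
  · rw [cjS_inr_inr, cjS_inr_inr, Bool.not_not]

/-- `cjS` has no fixed point. [folklore] -/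
theorem cjS_ne (y : PtS) : cjS y ≠ y := by
  rcases y with b | ⟨⟨a, b⟩ | ⟨a, b⟩⟩
  · rw [cjS_inl]; cases b <;> simp
  · rw [cjS_inr_inl]; cases b <;> simp
  · rw [cjS_inr_inr]; cases b <;> simp

/-- `cjS` is injective. [folklore] -/
theorem cjS_injective : Function.Injective cjS := fun y y' h => by rw [← cjS_cjS y, h, cjS_cjS]

/-- **`π⁻¹(types)` read in the model** (Boolean form): the threefold type is positive exactly at the pair `π.1⁻¹ 0`, the fourfold
type exactly at the pair `π.2⁻¹ 0`, the curve type is `{τ}`. [cite: GaoUllmo2025, Thm 3.1 (3.2)] -/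
def inPhiS (π : Equiv.Perm (Fin 3) × Equiv.Perm (Fin 4)) : PtS → Bool
  | Sum.inl b => b
  | Sum.inr (Sum.inl (a, b)) => b == decide (π.1 a = 0)
  | Sum.inr (Sum.inr (a, b)) => b == decide (π.2 a = 0)

/-- `π⁻¹(types)` as a finset of the model. [cite: GaoUllmo2025, Thm 3.1 (3.2)] -/
def phiS (π : Equiv.Perm (Fin 3) × Equiv.Perm (Fin 4)) : Finset PtS := univ.filter fun y => inPhiS π y = true

variable (π : Equiv.Perm (Fin 3) × Equiv.Perm (Fin 4))

/-- Membership, curve slot. [folklore] -/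
theorem inl_mem_phiS (b : Bool) : Sum.inl b ∈ phiS π ↔ b = true := by
  simp [phiS, inPhiS]

/-- Membership, threefold slot. [folklore] -/
theorem inr_inl_mem_phiS (a : Fin 3) (b : Bool) : Sum.inr (Sum.inl (a, b)) ∈ phiS π ↔ b = decide (π.1 a = 0) := by
  simp only [phiS, inPhiS, Finset.mem_filter, Finset.mem_univ, true_and, beq_iff_eq]

/-- Membership, fourfold slot. [folklore] -/
theorem inr_inr_mem_phiS (a : Fin 4) (b : Bool) : Sum.inr (Sum.inr (a, b)) ∈ phiS π ↔ b = decide (π.2 a = 0) := by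
  simp only [phiS, inPhiS, Finset.mem_filter, Finset.mem_univ, true_and, beq_iff_eq]

/-- Each `phiS π` is a CM type of the model: it contains exactly one of `y`, `cjS y`. [folklore] -/
theorem mem_phiS_iff_cjS_not_mem (y : PtS) : y ∈ phiS π ↔ cjS y ∉ phiS π := by
  rcases y with b | ⟨⟨a, b⟩ | ⟨a, b⟩⟩
  · rw [cjS_inl, inl_mem_phiS, inl_mem_phiS]
    cases b <;> simp
  · rw [cjS_inr_inl, inr_inl_mem_phiS, inr_inl_mem_phiS]
    cases b <;> cases decide (π.1 a = 0) <;> simp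
  · rw [cjS_inr_inr, inr_inr_mem_phiS, inr_inr_mem_phiS]
    cases b <;> cases decide (π.2 a = 0) <;> simp

/-- `phiS π` as an explicit finset: `{inl true} ⊔ {inr (inl (a, [π.1 a = 0]))} ⊔ {inr (inr (a, [π.2 a = 0]))}`. [folklore] -/
theorem phiS_eq : phiS π =
    insert (Sum.inl true)
      (((univ : Finset (Fin 3)).image fun a => (Sum.inr (Sum.inl (a, decide (π.1 a = 0))) : PtS)) ∪
        ((univ : Finset (Fin 4)).image fun a => (Sum.inr (Sum.inr (a, decide (π.2 a = 0))) : PtS))) := by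
  ext y
  rw [Finset.mem_insert, Finset.mem_union, Finset.mem_image, Finset.mem_image]
  rcases y with b | ⟨⟨a, b⟩ | ⟨a, b⟩⟩
  · rw [inl_mem_phiS]
    constructor
    · rintro rfl
      exact Or.inl rfl
    · rintro (h | ⟨q, -, hq⟩ | ⟨q, -, hq⟩)
      · exact Sum.inl_injective h
      · exact absurd hq Sum.inr_ne_inl
      · exact absurd hq Sum.inr_ne_inl
  · rw [inr_inl_mem_phiS]
    constructor
    · rintro rfl
      exact Or.inr (Or.inl ⟨a, Finset.mem_univ _, rfl⟩)
    · rintro (h | ⟨a', -, hq⟩ | ⟨a', -, hq⟩)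
      · exact absurd h Sum.inr_ne_inl
      · simp only [Sum.inr.injEq, Sum.inl.injEq, Prod.mk.injEq] at hq
        obtain ⟨rfl, rfl⟩ := hq
        rfl
      · simp only [Sum.inr.injEq] at hq
        exact absurd hq Sum.inr_ne_inl
  · rw [inr_inr_mem_phiS]
    constructor
    · rintro rfl
      exact Or.inr (Or.inr ⟨a, Finset.mem_univ _, rfl⟩)
    · rintro (h | ⟨a', -, hq⟩ | ⟨a', -, hq⟩)
      · exact absurd h Sum.inr_ne_inl
      · simp only [Sum.inr.injEq] at hq
        exact absurd hq Sum.inl_ne_inr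
      · simp only [Sum.inr.injEq, Prod.mk.injEq] at hq
        obtain ⟨rfl, rfl⟩ := hq
        rfl

/-! ### Balanced configurations -/

variable {α : Type*}

/-- **Pohlmann's condition for a configuration** of a product of copies of `E, T, B` under a set `R` of realised pairs of
permutations of the conjugate pairs: `2 · #{x ∈ T | v x ∈ π⁻¹(types)} = |T|` for `π ∈ R`. [cite: GaoUllmo2025, Thm 3.1 eq. (3.2)]
[cite: Pohlmann1968, Thm 1] -/
def ModelBalancedS (R : Finset (Equiv.Perm (Fin 3) × Equiv.Perm (Fin 4))) (v : α → PtS) (T : Finset α) : Prop :=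
  ∀ π ∈ R, 2 * (T.filter fun x => v x ∈ phiS π).card = T.card

variable (R : Finset (Equiv.Perm (Fin 3) × Equiv.Perm (Fin 4))) (v : α → PtS)

/-- The empty configuration is balanced. [folklore] -/
theorem modelBalancedS_empty : ModelBalancedS R v (∅ : Finset α) := fun _ _ => by simp

variable {R v}

/-- **Removing a balanced part keeps the balance.** [folklore] -/
theorem ModelBalancedS.sdiff [DecidableEq α] {T G : Finset α} (hT : ModelBalancedS R v T) (hG : ModelBalancedS R v G)
    (hGT : G ⊆ T) : ModelBalancedS R v (T \ G) := by
  intro π hπ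
  have key : ∀ (Q : α → Prop) [DecidablePred Q],
      ((T \ G).filter Q).card = (T.filter Q).card - (G.filter Q).card := by
    intro Q _
    rw [← Finset.card_sdiff_of_subset (Finset.filter_subset_filter Q hGT)]
    congr 1
    ext x
    simp only [Finset.mem_filter, Finset.mem_sdiff]
    tauto
  have h1 := hT π hπ
  have h2 := hG π hπ
  have h3 := Finset.card_sdiff_of_subset hGT
  have h4 : (G.filter fun x => v x ∈ phiS π).card ≤ (T.filter fun x => v x ∈ phiS π).card :=
    Finset.card_le_card (Finset.filter_subset_filter _ hGT)
  rw [key, h3]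
  omega

/-- **A disjoint union of balanced configurations is balanced.** [folklore] -/
theorem ModelBalancedS.union [DecidableEq α] {G S : Finset α} (hG : ModelBalancedS R v G) (hS : ModelBalancedS R v S)
    (hGS : Disjoint G S) : ModelBalancedS R v (G ∪ S) := by
  intro π hπ
  rw [Finset.filter_union, Finset.card_union_of_disjoint (Finset.disjoint_filter_filter hGS),
    Finset.card_union_of_disjoint hGS, mul_add, hG π hπ, hS π hπ]

/-! ### Counting fibrewise; the signed form -/

variable (v)

/-- `#{x ∈ T | v x ∈ W} = Σ_{y ∈ W} #{x ∈ T | v x = y}`. [folklore] -/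
theorem card_filter_mem_eq_sumS (T : Finset α) (W : Finset PtS) :
    (T.filter fun x => v x ∈ W).card = ∑ y ∈ W, (T.filter fun x => v x = y).card := by
  rw [Finset.card_eq_sum_card_fiberwise (f := v) (s := T.filter fun x => v x ∈ W) (t := W)
    (fun x hx => (Finset.mem_filter.1 (Finset.mem_coe.1 hx)).2)]
  refine Finset.sum_congr rfl fun y hy => ?_
  congr 1
  ext x
  simp only [Finset.mem_filter]
  constructor
  · rintro ⟨⟨hx, -⟩, hxy⟩; exact ⟨hx, hxy⟩
  · rintro ⟨hx, hxy⟩; exact ⟨⟨hx, hxy ▸ hy⟩, hxy⟩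

/-- `|T| = Σ_y #{x ∈ T | v x = y}`. [folklore] -/
theorem card_eq_sumS (T : Finset α) : T.card = ∑ y : PtS, (T.filter fun x => v x = y).card := by
  rw [← card_filter_mem_eq_sumS v T univ]
  congr 1
  ext x
  simp

/-- A sum over the model, expanded by slots. [folklore] -/
theorem sum_ptS (N : PtS → ℕ) : ∑ y : PtS, N y =
    N (Sum.inl true) + N (Sum.inl false) +
      (∑ a : Fin 3, (N (Sum.inr (Sum.inl (a, true))) + N (Sum.inr (Sum.inl (a, false)))) +
        ∑ a : Fin 4, (N (Sum.inr (Sum.inr (a, true))) + N (Sum.inr (Sum.inr (a, false))))) := by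
  rw [Fintype.sum_sum_type, Fintype.sum_bool, Fintype.sum_sum_type, Fintype.sum_prod_type, Fintype.sum_prod_type]
  simp only [Fintype.sum_bool]

/-- The sum over `phiS π`, expanded. [folklore] -/
theorem sum_phiS (N : PtS → ℕ) :
    ∑ y ∈ phiS π, N y = N (Sum.inl true) +
      (∑ a : Fin 3, N (Sum.inr (Sum.inl (a, decide (π.1 a = 0)))) + ∑ a : Fin 4, N (Sum.inr (Sum.inr (a, decide (π.2 a = 0))))) := by
  rw [phiS_eq π]
  have hinj₁ : Function.Injective fun a : Fin 3 => (Sum.inr (Sum.inl (a, decide (π.1 a = 0))) : PtS) := by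
    intro a a' h
    simp only [Sum.inr.injEq, Sum.inl.injEq, Prod.mk.injEq] at h
    exact h.1
  have hinj₂ : Function.Injective fun a : Fin 4 => (Sum.inr (Sum.inr (a, decide (π.2 a = 0))) : PtS) := by
    intro a a' h
    simp only [Sum.inr.injEq, Prod.mk.injEq] at h
    exact h.1
  have hdisj : Disjoint ((univ : Finset (Fin 3)).image fun a => (Sum.inr (Sum.inl (a, decide (π.1 a = 0))) : PtS))
      ((univ : Finset (Fin 4)).image fun a => (Sum.inr (Sum.inr (a, decide (π.2 a = 0))) : PtS)) := by
    rw [Finset.disjoint_left]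
    intro y hy hy'
    obtain ⟨a, -, rfl⟩ := Finset.mem_image.1 hy
    obtain ⟨a', -, h⟩ := Finset.mem_image.1 hy'
    simp only [Sum.inr.injEq] at h
    exact Sum.inr_ne_inl h
  have h1 : Sum.inl true ∉
      ((univ : Finset (Fin 3)).image fun a => (Sum.inr (Sum.inl (a, decide (π.1 a = 0))) : PtS)) ∪
        ((univ : Finset (Fin 4)).image fun a => (Sum.inr (Sum.inr (a, decide (π.2 a = 0))) : PtS)) := by simp
  rw [Finset.sum_insert h1, Finset.sum_union hdisj, Finset.sum_image fun a _ a' _ h => hinj₁ h,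
    Finset.sum_image fun a _ a' _ h => hinj₂ h]

/-- **The signed form of the balance equation at `π`**: `2 Σ_{y ∈ phiS π} N y = Σ_y N y` iff
`(N t − N f) + Σ_a ± d₁(a) + Σ_a ± d₂(a) = 0`, the signs being `+` iff `π.1 a = 0` resp. `π.2 a = 0`. [cite: GaoUllmo2025, Thm 3.1] -/
theorem balancedS_iff_signed (N : PtS → ℕ) :
    2 * ∑ y ∈ phiS π, N y = ∑ y : PtS, N y ↔
      ((N (Sum.inl true) : ℤ) - N (Sum.inl false)) +
        (∑ a : Fin 3, (if π.1 a = 0 then ((N (Sum.inr (Sum.inl (a, true))) : ℤ) - N (Sum.inr (Sum.inl (a, false))))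
            else -(((N (Sum.inr (Sum.inl (a, true))) : ℤ) - N (Sum.inr (Sum.inl (a, false))))))) +
        (∑ a : Fin 4, (if π.2 a = 0 then ((N (Sum.inr (Sum.inr (a, true))) : ℤ) - N (Sum.inr (Sum.inr (a, false))))
            else -(((N (Sum.inr (Sum.inr (a, true))) : ℤ) - N (Sum.inr (Sum.inr (a, false))))))) = 0 := by
  rw [sum_phiS, sum_ptS]
  have key₁ : ∀ a : Fin 3, (2 * (N (Sum.inr (Sum.inl (a, decide (π.1 a = 0)))) : ℤ)) =
      ((N (Sum.inr (Sum.inl (a, true))) : ℤ) + N (Sum.inr (Sum.inl (a, false)))) +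
        (if π.1 a = 0 then ((N (Sum.inr (Sum.inl (a, true))) : ℤ) - N (Sum.inr (Sum.inl (a, false))))
          else -(((N (Sum.inr (Sum.inl (a, true))) : ℤ) - N (Sum.inr (Sum.inl (a, false)))))) := by
    intro a
    by_cases h : π.1 a = 0
    · rw [decide_eq_true h, if_pos h]; ring
    · rw [decide_eq_false h, if_neg h]; ring
  have key₂ : ∀ a : Fin 4, (2 * (N (Sum.inr (Sum.inr (a, decide (π.2 a = 0)))) : ℤ)) =
      ((N (Sum.inr (Sum.inr (a, true))) : ℤ) + N (Sum.inr (Sum.inr (a, false)))) +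
        (if π.2 a = 0 then ((N (Sum.inr (Sum.inr (a, true))) : ℤ) - N (Sum.inr (Sum.inr (a, false))))
          else -(((N (Sum.inr (Sum.inr (a, true))) : ℤ) - N (Sum.inr (Sum.inr (a, false)))))) := by
    intro a
    by_cases h : π.2 a = 0
    · rw [decide_eq_true h, if_pos h]; ring
    · rw [decide_eq_false h, if_neg h]; ring
  have hsum₁ : (2 * (∑ a : Fin 3, N (Sum.inr (Sum.inl (a, decide (π.1 a = 0))))) : ℤ) =
      (∑ a : Fin 3, (((N (Sum.inr (Sum.inl (a, true))) : ℤ) + N (Sum.inr (Sum.inl (a, false)))))) +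
        ∑ a : Fin 3, (if π.1 a = 0 then ((N (Sum.inr (Sum.inl (a, true))) : ℤ) - N (Sum.inr (Sum.inl (a, false))))
          else -(((N (Sum.inr (Sum.inl (a, true))) : ℤ) - N (Sum.inr (Sum.inl (a, false)))))) := by
    push_cast
    rw [Finset.mul_sum, ← Finset.sum_add_distrib]
    exact Finset.sum_congr rfl fun a _ => key₁ a
  have hsum₂ : (2 * (∑ a : Fin 4, N (Sum.inr (Sum.inr (a, decide (π.2 a = 0))))) : ℤ) =
      (∑ a : Fin 4, (((N (Sum.inr (Sum.inr (a, true))) : ℤ) + N (Sum.inr (Sum.inr (a, false)))))) +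
        ∑ a : Fin 4, (if π.2 a = 0 then ((N (Sum.inr (Sum.inr (a, true))) : ℤ) - N (Sum.inr (Sum.inr (a, false))))
          else -(((N (Sum.inr (Sum.inr (a, true))) : ℤ) - N (Sum.inr (Sum.inr (a, false)))))) := by
    push_cast
    rw [Finset.mul_sum, ← Finset.sum_add_distrib]
    exact Finset.sum_congr rfl fun a _ => key₂ a
  constructor
  · intro h
    have hz : (2 : ℤ) * ((N (Sum.inl true) : ℤ) +
        (((∑ a : Fin 3, N (Sum.inr (Sum.inl (a, decide (π.1 a = 0))))) : ℕ) +
          ((∑ a : Fin 4, N (Sum.inr (Sum.inr (a, decide (π.2 a = 0))))) : ℕ) : ℤ)) =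
        (N (Sum.inl true) : ℤ) + N (Sum.inl false) +
          (((∑ a : Fin 3, (N (Sum.inr (Sum.inl (a, true))) + N (Sum.inr (Sum.inl (a, false))))) : ℕ) +
            ((∑ a : Fin 4, (N (Sum.inr (Sum.inr (a, true))) + N (Sum.inr (Sum.inr (a, false))))) : ℕ) : ℤ) := by
      exact_mod_cast h
    push_cast at hz hsum₁ hsum₂
    linarith
  · intro h
    have hz : (2 : ℤ) * ((N (Sum.inl true) : ℤ) +
        (((∑ a : Fin 3, N (Sum.inr (Sum.inl (a, decide (π.1 a = 0))))) : ℕ) +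
          ((∑ a : Fin 4, N (Sum.inr (Sum.inr (a, decide (π.2 a = 0))))) : ℕ) : ℤ)) =
        (N (Sum.inl true) : ℤ) + N (Sum.inl false) +
          (((∑ a : Fin 3, (N (Sum.inr (Sum.inl (a, true))) + N (Sum.inr (Sum.inl (a, false))))) : ℕ) +
            ((∑ a : Fin 4, (N (Sum.inr (Sum.inr (a, true))) + N (Sum.inr (Sum.inr (a, false))))) : ℕ) : ℤ) := by
      push_cast at hsum₁ hsum₂ ⊢
      linarith
    exact_mod_cast hz

variable {π} (R)

/-- **The defect of a configuration balanced under `R`, at `π ∈ R`** (the signed equation for the fibre counts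
`N y = #{x ∈ T | v x = y}`). [cite: GaoUllmo2025, Thm 3.1] -/
theorem signed_of_modelBalancedS {T : Finset α} (hT : ModelBalancedS R v T) {π : Equiv.Perm (Fin 3) × Equiv.Perm (Fin 4)}
    (hπ : π ∈ R) :
    (((T.filter fun x => v x = Sum.inl true).card : ℤ) - (T.filter fun x => v x = Sum.inl false).card) +
      (∑ a : Fin 3, (if π.1 a = 0 then
        (((T.filter fun x => v x = Sum.inr (Sum.inl (a, true))).card : ℤ) -
          (T.filter fun x => v x = Sum.inr (Sum.inl (a, false))).card)
        else -((((T.filter fun x => v x = Sum.inr (Sum.inl (a, true))).card : ℤ) -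
          (T.filter fun x => v x = Sum.inr (Sum.inl (a, false))).card)))) +
      (∑ a : Fin 4, (if π.2 a = 0 then
        (((T.filter fun x => v x = Sum.inr (Sum.inr (a, true))).card : ℤ) -
          (T.filter fun x => v x = Sum.inr (Sum.inr (a, false))).card)
        else -((((T.filter fun x => v x = Sum.inr (Sum.inr (a, true))).card : ℤ) -
          (T.filter fun x => v x = Sum.inr (Sum.inr (a, false))).card)))) = 0 := by
  rw [← balancedS_iff_signed π fun y => (T.filter fun x => v x = y).card, ← card_filter_mem_eq_sumS, ← card_eq_sumS v T]
  exact hT π hπ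

/-- **Conversely: a configuration whose fibre counts satisfy the signed equation at `π` is balanced at `π`.** [folklore] -/
theorem balancedS_of_signed {T : Finset α} {π : Equiv.Perm (Fin 3) × Equiv.Perm (Fin 4)}
    (h : (((T.filter fun x => v x = Sum.inl true).card : ℤ) - (T.filter fun x => v x = Sum.inl false).card) +
      (∑ a : Fin 3, (if π.1 a = 0 then
        (((T.filter fun x => v x = Sum.inr (Sum.inl (a, true))).card : ℤ) -
          (T.filter fun x => v x = Sum.inr (Sum.inl (a, false))).card)
        else -((((T.filter fun x => v x = Sum.inr (Sum.inl (a, true))).card : ℤ) -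
          (T.filter fun x => v x = Sum.inr (Sum.inl (a, false))).card)))) +
      (∑ a : Fin 4, (if π.2 a = 0 then
        (((T.filter fun x => v x = Sum.inr (Sum.inr (a, true))).card : ℤ) -
          (T.filter fun x => v x = Sum.inr (Sum.inr (a, false))).card)
        else -((((T.filter fun x => v x = Sum.inr (Sum.inr (a, true))).card : ℤ) -
          (T.filter fun x => v x = Sum.inr (Sum.inr (a, false))).card)))) = 0) :
    2 * (T.filter fun x => v x ∈ phiS π).card = T.card := by
  rw [card_filter_mem_eq_sumS, card_eq_sumS v T, balancedS_iff_signed]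
  exact h

end Summit.HodgeConjecture.CorCM.Census.SexticOcticWeil
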